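import Literature.Analysis.FluidPDE.SqIntegralBalance
import Literature.Analysis.FluidPDE.AxisymQuotientRayAverage
import Literature.Analysis.FluidPDE.AxisymQuotientEquationsOmega
import Literature.Analysis.FluidPDE.TaoClassGlue
import HarnessLib

/-!
# The `L²` balances of `Ω = ω^θ/r` and `J = ωʳ/r` along a Tao-class axisymmetric solution

Analysis/FluidPDE proof file (theorems only; no definitions, no named facts) on the discharge path
of the named facts `Literature.Analysis.FluidPDE.LeiZhang2017_logModulus_regularity`,
`…LeiZhang2017_smallSwirl_regularity`, `…Wei2016_logModulus_regularity` (Lei–Zhang 2017,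
arXiv:1505.02628, §3, "Integrating the above inequality with respect to time", p. 8–9).

For a Tao-class solution `v` on `[0, T]` (`IsTaoSolutionOn T ν u₀ v q`) with axisymmetric
slices, the quotients `Ω(t) = angVortQuot (v t)` and `J(t) = radVelQuot (curl (v t))` obey

* `IsTaoSolutionOn.integral_sq_angVortQuot_eq` —
  `∫ Ω(b)² = ∫ Ω(0)² + 2∫_{(0,b)} ∫ Ω(t) Ω'(t)` for `b ∈ (0, T]`, `Ω' = angVortQuot (∂ₜv)`;
* `IsTaoSolutionOn.integral_sq_radVelQuot_curl_eq` — the same for `J`, `J' = radVelQuot (curl ∂ₜv)`,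

where `∂ₜ = timeDerivWithin (Icc 0 T)`. Proof: off the (null) axis `Ω(t,x) = r⁻² ⟪Jx, ω(t,x)⟫`,
`J(t,x) = r⁻²(x₀ω₀ + x₁ω₁)(t,x)` are time lines of jointly smooth fields, with derivatives
`r⁻²⟪Jx, ∂ₜω⟫ = Ω'`, …, (`∂ₜω = curl ∂ₜv`, `IsSmoothSpaceTimeOn.timeDerivWithin_vorticity_eq`);
the products `ΩΩ'`, `JJ'` are uniformly `L¹` by the Sobolev bounds of the quotient families
(`AxisymQuotientRayAverage`); conclude with `integral_sq_eq_add_of_ae_hasDerivAt`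
(`SqIntegralBalance`). Also recorded: the uniform `L²` bounds and square-integrability of the
four families `Ω, Ω', J, J'` on `[0, T]` (`IsTaoSolutionOn.exists_lintegral_sq_quot_le`), and
`hasBoundedSobolevNormsOn_curl`; and the integrability in time of the pairings
`t ↦ ∫ Ω(t)Ω'(t)`, `t ↦ ∫ J(t)J'(t)` on `(0, T)` (`IsTaoSolutionOn.integrableOn_integral_angVortQuot_mul`,
`…_radVelQuot_curl_mul`, Fubini).

## References

* Z. Lei, Q. S. Zhang, Pacific J. Math. 289 (2017) 169–187, arXiv:1505.02628, §3, pp. 8–9.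
  [`LeiZhang2017`]
-/

noncomputable section

open MeasureTheory Set Function Filter Topology InnerProductSpace WithLp
open scoped RealInnerProductSpace ContDiff ENNReal NNReal Topology

namespace Literature.Analysis.FluidPDE

/-! ### Sobolev bounds of curl families; `L²` facts -/

section Families

variable {S : Set ℝ} {u : ℝ → EuclideanSpace ℝ (Fin 3) → EuclideanSpace ℝ (Fin 3)}

/-- The vorticity family of a family with bounded Sobolev norms has bounded Sobolev norms
(`‖Dⁿ(curl w)‖ ≤ ‖curlCLM‖ ‖Dⁿ⁺¹w‖`). [folklore] -/
theorem hasBoundedSobolevNormsOn_curl (hH : HasBoundedSobolevNormsOn S u)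
    (hsm : ∀ t ∈ S, ContDiff ℝ ∞ (u t)) : HasBoundedSobolevNormsOn S fun t => curl (u t) := by
  intro n
  obtain ⟨C, hC⟩ := hH (n + 1)
  set c : ℝ := ‖(curlCLM : (EuclideanSpace ℝ (Fin 3) →L[ℝ] EuclideanSpace ℝ (Fin 3)) →L[ℝ]
      EuclideanSpace ℝ (Fin 3))‖ with hc
  have hc0 : 0 ≤ c := by positivity
  refine ⟨Real.toNNReal (c ^ 2) * C, fun t ht => ?_⟩
  have hn1 : ContDiff ℝ (n + 1) (u t) := (hsm t ht).of_le (by exact_mod_cast le_top)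
  calc ∫⁻ x, ‖iteratedFDeriv ℝ n (curl (u t)) x‖ₑ ^ 2
      ≤ ∫⁻ x, (ENNReal.ofReal c * ‖iteratedFDeriv ℝ (n + 1) (u t) x‖ₑ) ^ 2 := by
        refine lintegral_mono fun x => ?_
        gcongr
        rw [← ofReal_norm, ← ofReal_norm, ← ENNReal.ofReal_mul hc0]
        exact ENNReal.ofReal_le_ofReal (norm_iteratedFDeriv_curl_le hn1 x)
    _ = ENNReal.ofReal (c ^ 2) * ∫⁻ x, ‖iteratedFDeriv ℝ (n + 1) (u t) x‖ₑ ^ 2 := by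
        rw [← lintegral_const_mul' _ _ ENNReal.ofReal_ne_top]
        refine lintegral_congr fun x => ?_
        rw [mul_pow, ENNReal.ofReal_pow hc0]
    _ ≤ (Real.toNNReal (c ^ 2) : ℝ≥0∞) * C := by
        rw [ENNReal.ofReal]
        exact mul_le_mul' le_rfl (hC t ht)
    _ = ((Real.toNNReal (c ^ 2) * C : ℝ≥0) : ℝ≥0∞) := by rw [ENNReal.coe_mul]

/-- A continuous real function with `∫ |f|² ≤ C < ∞` is in `L²`. [folklore] -/
theorem memLp_two_of_lintegral_sq_le_coe {f : EuclideanSpace ℝ (Fin 3) → ℝ} (hf : Continuous f) {C : ℝ≥0}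
    (h : ∫⁻ x, ‖f x‖ₑ ^ 2 ≤ C) : MemLp f 2 volume :=
  ⟨hf.aestronglyMeasurable, eLpNorm_two_lt_top_of_lintegral_enorm_sq_lt_top
    (h.trans_lt ENNReal.coe_lt_top)⟩

end Families

/-! ### The balances -/

section Balance

variable {T ν : ℝ} {u₀ : EuclideanSpace ℝ (Fin 3) → EuclideanSpace ℝ (Fin 3)}
  {v : ℝ → EuclideanSpace ℝ (Fin 3) → EuclideanSpace ℝ (Fin 3)} {q : ℝ → EuclideanSpace ℝ (Fin 3) → ℝ}

/-- For `0 < T`, `Icc 0 T ⊆ closure (interior (Icc 0 T))`. [folklore] -/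
theorem Icc_subset_closure_interior_Icc' (hT : 0 < T) : Icc (0 : ℝ) T ⊆ closure (interior (Icc 0 T)) := by
  rw [interior_Icc, closure_Ioo hT.ne]

/-- **Uniform `L²` bounds of the four quotient families** `Ω(t) = angVortQuot (v t)`,
`Ω'(t) = angVortQuot (∂ₜv t)`, `J(t) = radVelQuot (curl (v t))`, `J'(t) = radVelQuot (curl (∂ₜv t))`
along a Tao-class solution with axisymmetric slices. [folklore] -/
theorem IsTaoSolutionOn.exists_lintegral_sq_quot_le (h : IsTaoSolutionOn T ν u₀ v q) (hT : 0 < T)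
    (hax : ∀ t ∈ Icc 0 T, IsAxisymmetric (v t)) :
    ∃ C : ℝ≥0, ∀ t ∈ Icc 0 T,
      ∫⁻ x, ‖angVortQuot (v t) x‖ₑ ^ 2 ≤ C ∧
      ∫⁻ x, ‖angVortQuot (timeDerivWithin (Icc 0 T) v t) x‖ₑ ^ 2 ≤ C ∧
      ∫⁻ x, ‖radVelQuot (curl (v t)) x‖ₑ ^ 2 ≤ C ∧
      ∫⁻ x, ‖radVelQuot (curl (timeDerivWithin (Icc 0 T) v t)) x‖ₑ ^ 2 ≤ C := by
  have hU : UniqueDiffOn ℝ (Icc 0 T) := uniqueDiffOn_Icc hT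
  have hsm : IsSmoothSpaceTimeOn (Icc 0 T) v := h.classical.smooth_velocity
  have hvs : ∀ t ∈ Icc 0 T, ContDiff ℝ ∞ (v t) := fun t ht => h.classical.contDiff_velocity ht
  have hws : ∀ t ∈ Icc 0 T, ContDiff ℝ ∞ (timeDerivWithin (Icc 0 T) v t) := fun t ht =>
    hsm.contDiff_timeDerivWithin_slice hU ht
  have hwax : ∀ t ∈ Icc 0 T, IsAxisymmetric (timeDerivWithin (Icc 0 T) v t) := fun t ht =>
    hsm.isAxisymmetric_timeDerivWithin hax ht
  have hcs : ∀ t ∈ Icc 0 T, ContDiff ℝ ∞ (curl (v t)) := fun t ht => by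
    rw [curl_eq_curlCLM_comp]; exact curlCLM.contDiff.comp ((hvs t ht).fderiv_right (m := ∞) (by simp))
  have hcws : ∀ t ∈ Icc 0 T, ContDiff ℝ ∞ (curl (timeDerivWithin (Icc 0 T) v t)) := fun t ht => by
    rw [curl_eq_curlCLM_comp]; exact curlCLM.contDiff.comp ((hws t ht).fderiv_right (m := ∞) (by simp))
  have hcax : ∀ t ∈ Icc 0 T, IsAxisymmetric (curl (v t)) := fun t ht =>
    (hax t ht).curl ((hvs t ht).differentiable (by simp))
  have hcwax : ∀ t ∈ Icc 0 T, IsAxisymmetric (curl (timeDerivWithin (Icc 0 T) v t)) := fun t ht =>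
    (hwax t ht).curl ((hws t ht).differentiable (by simp))
  obtain ⟨C₁, hC₁⟩ := exists_lintegral_sq_iteratedFDeriv_angVortQuot_le hvs hax h.sobolev 0
  obtain ⟨C₂, hC₂⟩ := exists_lintegral_sq_iteratedFDeriv_angVortQuot_le hws hwax h.sobolev_dt 0
  obtain ⟨C₃, hC₃⟩ := exists_lintegral_sq_iteratedFDeriv_radVelQuot_le hcs hcax
    (hasBoundedSobolevNormsOn_curl h.sobolev hvs) 0
  obtain ⟨C₄, hC₄⟩ := exists_lintegral_sq_iteratedFDeriv_radVelQuot_le hcws hcwax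
    (hasBoundedSobolevNormsOn_curl h.sobolev_dt hws) 0
  refine ⟨C₁ + C₂ + C₃ + C₄, fun t ht => ?_⟩
  have e : ∀ (f : EuclideanSpace ℝ (Fin 3) → ℝ), ∫⁻ x, ‖f x‖ₑ ^ 2 = ∫⁻ x, ‖iteratedFDeriv ℝ 0 f x‖ₑ ^ 2 :=
    fun f => lintegral_congr fun x => by rw [← ofReal_norm, ← ofReal_norm, norm_iteratedFDeriv_zero]
  have i1 : C₁ ≤ C₁ + C₂ + C₃ + C₄ := le_add_right (le_add_right (le_add_right le_rfl))
  have i2 : C₂ ≤ C₁ + C₂ + C₃ + C₄ := le_add_right (le_add_right (le_add_left le_rfl))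
  have i3 : C₃ ≤ C₁ + C₂ + C₃ + C₄ := le_add_right (le_add_left le_rfl)
  have i4 : C₄ ≤ C₁ + C₂ + C₃ + C₄ := le_add_left le_rfl
  refine ⟨?_, ?_, ?_, ?_⟩
  · rw [e]; exact (hC₁ t ht).trans (ENNReal.coe_le_coe.2 i1)
  · rw [e]; exact (hC₂ t ht).trans (ENNReal.coe_le_coe.2 i2)
  · rw [e]; exact (hC₃ t ht).trans (ENNReal.coe_le_coe.2 i3)
  · rw [e]; exact (hC₄ t ht).trans (ENNReal.coe_le_coe.2 i4)

/-- `⟪(x₀, x₁, 0), w⟫ = x₀w₀ + x₁w₁`. [folklore] -/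
private theorem inner_horizontal (x w : EuclideanSpace ℝ (Fin 3)) :
    ⟪(toLp 2 ![x 0, x 1, 0] : EuclideanSpace ℝ (Fin 3)), w⟫ = x 0 * w 0 + x 1 * w 1 := by
  simp [PiLp.inner_apply, Fin.sum_univ_three]
  ring

/-- **The `L²` balance of a weighted pairing of the vorticity** along a Tao-class solution
(the common proof of the `Ω`- and `J`-balances): let `ℓ x : ℝ³ →L ℝ` be given by pairing with a
fixed vector `a x` (measurable in `x`… here simply any family of vectors), and let `g t x`,
`g' t x` be real functions with, for `t ∈ [0, T]` and `r(x) ≠ 0`,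
`g t x = r⁻² ⟪a x, ω(t,x)⟫`, `g' t x = r⁻² ⟪a x, curl (∂ₜv t) x⟫`, where `a` is continuous; assume
uniform `L²` bounds `∫ g(t)², ∫ g'(t)² ≤ C` and continuity of the slices. Then
`∫ g(b)² = ∫ g(0)² + 2∫_{(0,b)}∫ g g'` for `b ∈ (0, T]`. [folklore] -/
theorem IsTaoSolutionOn.integral_sq_eq_of_repr (h : IsTaoSolutionOn T ν u₀ v q) (hT : 0 < T)
    {g g' : ℝ → EuclideanSpace ℝ (Fin 3) → ℝ} {a : EuclideanSpace ℝ (Fin 3) → EuclideanSpace ℝ (Fin 3)}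
    (ha : Continuous a)
    (hg : ∀ t ∈ Icc 0 T, ∀ x, cylRadius x ≠ 0 →
      g t x = (cylRadius x ^ 2)⁻¹ * ⟪a x, vorticity v t x⟫)
    (hg' : ∀ t ∈ Icc 0 T, ∀ x, cylRadius x ≠ 0 →
      g' t x = (cylRadius x ^ 2)⁻¹ * ⟪a x, curl (timeDerivWithin (Icc 0 T) v t) x⟫)
    (hgc : ∀ t ∈ Icc 0 T, Continuous (g t))
    {C : ℝ≥0} (hgb : ∀ t ∈ Icc 0 T, ∫⁻ x, ‖g t x‖ₑ ^ 2 ≤ C) (hg'b : ∀ t ∈ Icc 0 T, ∫⁻ x, ‖g' t x‖ₑ ^ 2 ≤ C)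
    {b : ℝ} (hb : b ∈ Ioc 0 T) :
    ∫ x, g b x ^ 2 = (∫ x, g 0 x ^ 2) + 2 * ∫ t in Ioo 0 b, ∫ x, g t x * g' t x := by
  have hU : UniqueDiffOn ℝ (Icc 0 T) := uniqueDiffOn_Icc hT
  have hcl := Icc_subset_closure_interior_Icc' hT
  have hsm : IsSmoothSpaceTimeOn (Icc 0 T) v := h.classical.smooth_velocity
  have hω : IsSmoothSpaceTimeOn (Icc 0 T) (vorticity v) := hsm.isSmoothSpaceTimeOn_vorticity hU
  have hω' : IsSmoothSpaceTimeOn (Icc 0 T) (timeDerivWithin (Icc 0 T) (vorticity v)) := hω.timeDerivWithin hU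
  -- `∂ₜω = curl ∂ₜv`
  have hcurl : ∀ t ∈ Icc 0 T, timeDerivWithin (Icc 0 T) (vorticity v) t = curl (timeDerivWithin (Icc 0 T) v t) :=
    fun t ht => hsm.timeDerivWithin_vorticity_eq hU hcl ht
  -- the smooth representatives
  set G : ℝ → EuclideanSpace ℝ (Fin 3) → ℝ := fun t x => (cylRadius x ^ 2)⁻¹ * ⟪a x, vorticity v t x⟫ with hG
  set G' : ℝ → EuclideanSpace ℝ (Fin 3) → ℝ := fun t x =>
    (cylRadius x ^ 2)⁻¹ * ⟪a x, timeDerivWithin (Icc 0 T) (vorticity v) t x⟫ with hG'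
  have hg'G : ∀ t ∈ Icc 0 T, ∀ x, cylRadius x ≠ 0 → g' t x = G' t x := by
    intro t ht x hx
    simp only [hG', hcurl t ht]
    exact hg' t ht x hx
  -- time lines of jointly continuous fields are continuous
  have tl : ∀ {w : ℝ → EuclideanSpace ℝ (Fin 3) → EuclideanSpace ℝ (Fin 3)},
      ContinuousOn (uncurry w) (Icc 0 T ×ˢ univ) → ∀ x, ContinuousOn (fun s => w s x) (Icc 0 T) := by
    intro w hw x
    exact hw.comp (continuous_id.prodMk continuous_const).continuousOn
      fun s hs => mk_mem_prod hs (mem_univ x)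
  refine integral_sq_eq_add_of_ae_hasDerivAt (T := T) ?_ ?_ (K := (C : ℝ≥0∞) + C) (by simp) ?_ ?_ hb
  · -- time lines, off the axis
    have hae : ∀ᵐ x ∂(volume : Measure (EuclideanSpace ℝ (Fin 3))), cylRadius x ≠ 0 := by
      rw [ae_iff]; simp only [ne_eq, not_not]; exact volume_setOf_cylRadius_eq_zero
    filter_upwards [hae] with x hx
    -- continuity of the vorticity time line and of its time derivative
    have cω : ContinuousOn (fun s => vorticity v s x) (Icc 0 T) := tl hω.continuousOn x
    have cω' : ContinuousOn (fun s => timeDerivWithin (Icc 0 T) (vorticity v) s x) (Icc 0 T) :=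
      tl hω'.continuousOn x
    have cG : ContinuousOn (fun s => G s x) (Icc 0 T) :=
      continuousOn_const.mul ((continuous_const.inner continuous_id).comp_continuousOn cω)
    have cG' : ContinuousOn (fun s => G' s x) (Icc 0 T) :=
      continuousOn_const.mul ((continuous_const.inner continuous_id).comp_continuousOn cω')
    refine ⟨cG.congr fun s hs => hg s hs x hx, cG'.congr fun s hs => hg'G s hs x hx, fun t ht => ?_⟩
    have htI : t ∈ Icc 0 T := Ioo_subset_Icc_self ht
    -- derivative of the vorticity time line within `Icc`, at an interior time
    have hdω : HasDerivWithinAt (fun s => vorticity v s x) (timeDerivWithin (Icc 0 T) (vorticity v) t x)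
        (Icc 0 T) t := by
      rw [timeDerivWithin_apply]
      exact (hω.differentiableWithinAt_time htI x).hasDerivWithinAt
    have hdω' : HasDerivAt (fun s => vorticity v s x) (timeDerivWithin (Icc 0 T) (vorticity v) t x) t :=
      hdω.hasDerivAt (Icc_mem_nhds ht.1 ht.2)
    have h1 : HasDerivAt (fun s => ⟪a x, vorticity v s x⟫)
        ⟪a x, timeDerivWithin (Icc 0 T) (vorticity v) t x⟫ t := by
      have := (innerSL ℝ (a x)).hasFDerivAt.comp_hasDerivAt t hdω'
      simpa [Function.comp_def] using this
    have hdG : HasDerivAt (fun s => G s x) (G' t x) t := by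
      simp only [hG, hG']
      exact h1.const_mul _
    -- transfer to `g`
    have heq : (fun s => g s x) =ᶠ[𝓝 t] fun s => G s x := by
      filter_upwards [Icc_mem_nhds ht.1 ht.2] with s hs
      exact hg s hs x hx
    rw [hg'G t htI x hx]
    exact hdG.congr_of_eventuallyEq heq
  · -- joint measurability from continuity off the axis
    refine aestronglyMeasurable_prod_of_continuousOn_off_axis (F := uncurry fun t x => g t x * g' t x) ?_
    have cω : ContinuousOn (uncurry (vorticity v)) (Icc 0 T ×ˢ univ) := hω.continuousOn
    have cω' : ContinuousOn (uncurry (timeDerivWithin (Icc 0 T) (vorticity v))) (Icc 0 T ×ˢ univ) :=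
      hω'.continuousOn
    have hsub : Ioo 0 T ×ˢ {x : EuclideanSpace ℝ (Fin 3) | cylRadius x ≠ 0} ⊆ Icc 0 T ×ˢ univ :=
      prod_mono Ioo_subset_Icc_self (subset_univ _)
    have cr : ContinuousOn (fun p : ℝ × EuclideanSpace ℝ (Fin 3) => (cylRadius p.2 ^ 2)⁻¹)
        (Ioo 0 T ×ˢ {x | cylRadius x ≠ 0}) := by
      refine ((continuous_cylRadius.comp continuous_snd).pow 2).continuousOn.inv₀ fun p hp => ?_
      exact pow_ne_zero 2 hp.2
    have ca : Continuous fun p : ℝ × EuclideanSpace ℝ (Fin 3) => a p.2 := ha.comp continuous_snd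
    have cF : ContinuousOn (fun p : ℝ × EuclideanSpace ℝ (Fin 3) =>
        ((cylRadius p.2 ^ 2)⁻¹ * ⟪a p.2, uncurry (vorticity v) p⟫) *
          ((cylRadius p.2 ^ 2)⁻¹ * ⟪a p.2, uncurry (timeDerivWithin (Icc 0 T) (vorticity v)) p⟫))
        (Ioo 0 T ×ˢ {x | cylRadius x ≠ 0}) :=
      (cr.mul (ca.continuousOn.inner (cω.mono hsub))).mul (cr.mul (ca.continuousOn.inner (cω'.mono hsub)))
    refine cF.congr fun p hp => ?_
    obtain ⟨t, x⟩ := p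
    have ht : t ∈ Icc 0 T := Ioo_subset_Icc_self hp.1
    simp only [uncurry_apply_pair]
    rw [hg t ht x hp.2, hg'G t ht x hp.2]
  · -- uniform `L¹` bound of `g g'`
    intro t ht
    have htI : t ∈ Icc 0 T := Ioo_subset_Icc_self ht
    calc ∫⁻ x, ‖g t x * g' t x‖ₑ ≤ ∫⁻ x, (‖g t x‖ₑ ^ 2 + ‖g' t x‖ₑ ^ 2) :=
          lintegral_mono fun x => by rw [enorm_mul]; exact ennreal_mul_le_sq_add_sq _ _
      _ = (∫⁻ x, ‖g t x‖ₑ ^ 2) + ∫⁻ x, ‖g' t x‖ₑ ^ 2 :=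
          lintegral_add_left ((hgc t htI).measurable.enorm.pow_const 2) _
      _ ≤ C + C := add_le_add (hgb t htI) (hg'b t htI)
  · intro t ht
    exact (memLp_two_of_lintegral_sq_le_coe (hgc t ht) (hgb t ht)).integrable_sq

/-- **The `L²` balance of `Ω = ω^θ/r`** along a Tao-class solution with axisymmetric slices:
`∫ Ω(b)² = ∫ Ω(0)² + 2∫_{(0,b)} ∫ Ω(t) Ω'(t)` for `b ∈ (0, T]`, `Ω(t) = angVortQuot (v t)`,
`Ω'(t) = angVortQuot (∂ₜv t)`. [cite: LeiZhang2017, §3 (integration in time, arXiv pp. 8–9)] -/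
theorem IsTaoSolutionOn.integral_sq_angVortQuot_eq (h : IsTaoSolutionOn T ν u₀ v q) (hT : 0 < T)
    (hax : ∀ t ∈ Icc 0 T, IsAxisymmetric (v t)) {b : ℝ} (hb : b ∈ Ioc 0 T) :
    ∫ x, angVortQuot (v b) x ^ 2 = (∫ x, angVortQuot (v 0) x ^ 2) +
      2 * ∫ t in Ioo 0 b, ∫ x, angVortQuot (v t) x * angVortQuot (timeDerivWithin (Icc 0 T) v t) x := by
  have hU : UniqueDiffOn ℝ (Icc 0 T) := uniqueDiffOn_Icc hT
  have hsm : IsSmoothSpaceTimeOn (Icc 0 T) v := h.classical.smooth_velocity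
  have hvs : ∀ t ∈ Icc 0 T, ContDiff ℝ ∞ (v t) := fun t ht => h.classical.contDiff_velocity ht
  have hws : ∀ t ∈ Icc 0 T, ContDiff ℝ ∞ (timeDerivWithin (Icc 0 T) v t) := fun t ht =>
    hsm.contDiff_timeDerivWithin_slice hU ht
  have hwax : ∀ t ∈ Icc 0 T, IsAxisymmetric (timeDerivWithin (Icc 0 T) v t) := fun t ht =>
    hsm.isAxisymmetric_timeDerivWithin hax ht
  obtain ⟨C, hC⟩ := h.exists_lintegral_sq_quot_le hT hax
  refine h.integral_sq_eq_of_repr hT (a := rotGen) (g := fun t x => angVortQuot (v t) x)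
    (g' := fun t x => angVortQuot (timeDerivWithin (Icc 0 T) v t) x) ?_ ?_ ?_ ?_
    (fun t ht => (hC t ht).1) (fun t ht => (hC t ht).2.1) hb
  · exact (rotGenL).continuous
  · intro t ht x hx
    have h3 : ContDiff ℝ 3 (v t) := (hvs t ht).of_le (by norm_cast)
    have e := (hax t ht).cylRadius_sq_mul_angVortQuot h3 x
    rw [swirl_eq_inner_rotGen] at e
    simp only at e
    show angVortQuot (v t) x = (cylRadius x ^ 2)⁻¹ * ⟪rotGen x, curl (v t) x⟫
    rw [← e, ← mul_assoc, inv_mul_cancel₀ (pow_ne_zero 2 hx), one_mul]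
  · intro t ht x hx
    have h3 : ContDiff ℝ 3 (timeDerivWithin (Icc 0 T) v t) := (hws t ht).of_le (by norm_cast)
    have e := (hwax t ht).cylRadius_sq_mul_angVortQuot h3 x
    rw [swirl_eq_inner_rotGen] at e
    simp only at e
    show angVortQuot (timeDerivWithin (Icc 0 T) v t) x =
      (cylRadius x ^ 2)⁻¹ * ⟪rotGen x, curl (timeDerivWithin (Icc 0 T) v t) x⟫
    rw [← e, ← mul_assoc, inv_mul_cancel₀ (pow_ne_zero 2 hx), one_mul]
  · intro t ht
    exact (contDiff_angVortQuot (n := 0) (by exact_mod_cast (hvs t ht).of_le (by norm_cast))).continuous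

/-- **The `L²` balance of `J = ωʳ/r`** along a Tao-class solution with axisymmetric slices:
`∫ J(b)² = ∫ J(0)² + 2∫_{(0,b)} ∫ J(t) J'(t)` for `b ∈ (0, T]`, `J(t) = radVelQuot (curl (v t))`,
`J'(t) = radVelQuot (curl (∂ₜv t))`. [cite: LeiZhang2017, §3 (integration in time, arXiv pp. 8–9)] -/
theorem IsTaoSolutionOn.integral_sq_radVelQuot_curl_eq (h : IsTaoSolutionOn T ν u₀ v q) (hT : 0 < T)
    (hax : ∀ t ∈ Icc 0 T, IsAxisymmetric (v t)) {b : ℝ} (hb : b ∈ Ioc 0 T) :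
    ∫ x, radVelQuot (curl (v b)) x ^ 2 = (∫ x, radVelQuot (curl (v 0)) x ^ 2) +
      2 * ∫ t in Ioo 0 b, ∫ x, radVelQuot (curl (v t)) x *
        radVelQuot (curl (timeDerivWithin (Icc 0 T) v t)) x := by
  have hU : UniqueDiffOn ℝ (Icc 0 T) := uniqueDiffOn_Icc hT
  have hsm : IsSmoothSpaceTimeOn (Icc 0 T) v := h.classical.smooth_velocity
  have hvs : ∀ t ∈ Icc 0 T, ContDiff ℝ ∞ (v t) := fun t ht => h.classical.contDiff_velocity ht
  have hws : ∀ t ∈ Icc 0 T, ContDiff ℝ ∞ (timeDerivWithin (Icc 0 T) v t) := fun t ht =>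
    hsm.contDiff_timeDerivWithin_slice hU ht
  have hwax : ∀ t ∈ Icc 0 T, IsAxisymmetric (timeDerivWithin (Icc 0 T) v t) := fun t ht =>
    hsm.isAxisymmetric_timeDerivWithin hax ht
  have hcs : ∀ {w : EuclideanSpace ℝ (Fin 3) → EuclideanSpace ℝ (Fin 3)}, ContDiff ℝ ∞ w →
      ContDiff ℝ 2 (curl w) := fun hw => by
    rw [curl_eq_curlCLM_comp]
    exact curlCLM.contDiff.comp ((hw.of_le (by norm_cast)).fderiv_right (m := 2) (by norm_cast))
  obtain ⟨C, hC⟩ := h.exists_lintegral_sq_quot_le hT hax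
  refine h.integral_sq_eq_of_repr hT (a := fun x => toLp 2 ![x 0, x 1, 0])
    (g := fun t x => radVelQuot (curl (v t)) x)
    (g' := fun t x => radVelQuot (curl (timeDerivWithin (Icc 0 T) v t)) x) ?_ ?_ ?_ ?_
    (fun t ht => (hC t ht).2.2.1) (fun t ht => (hC t ht).2.2.2) hb
  · fun_prop
  · intro t ht x hx
    have hωax : IsAxisymmetric (curl (v t)) := (hax t ht).curl ((hvs t ht).differentiable (by simp))
    have e := hωax.cylRadius_sq_mul_radVelQuot (hcs (hvs t ht)) x
    show radVelQuot (curl (v t)) x =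
      (cylRadius x ^ 2)⁻¹ * ⟪(toLp 2 ![x 0, x 1, 0] : EuclideanSpace ℝ (Fin 3)), curl (v t) x⟫
    rw [inner_horizontal, ← e, ← mul_assoc, inv_mul_cancel₀ (pow_ne_zero 2 hx), one_mul]
  · intro t ht x hx
    have hωax : IsAxisymmetric (curl (timeDerivWithin (Icc 0 T) v t)) :=
      (hwax t ht).curl ((hws t ht).differentiable (by simp))
    have e := hωax.cylRadius_sq_mul_radVelQuot (hcs (hws t ht)) x
    show radVelQuot (curl (timeDerivWithin (Icc 0 T) v t)) x = (cylRadius x ^ 2)⁻¹ *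
      ⟪(toLp 2 ![x 0, x 1, 0] : EuclideanSpace ℝ (Fin 3)), curl (timeDerivWithin (Icc 0 T) v t) x⟫
    rw [inner_horizontal, ← e, ← mul_assoc, inv_mul_cancel₀ (pow_ne_zero 2 hx), one_mul]
  · intro t ht
    exact (contDiff_radVelQuot (n := 0) (by exact_mod_cast hcs (hvs t ht))).continuous

end Balance

/-! ### Integrability in time of the pairings `∫ Ω Ω'`, `∫ J J'` -/

section IntegrableOn

variable {T ν : ℝ} {u₀ : EuclideanSpace ℝ (Fin 3) → EuclideanSpace ℝ (Fin 3)}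
  {v : ℝ → EuclideanSpace ℝ (Fin 3) → EuclideanSpace ℝ (Fin 3)} {q : ℝ → EuclideanSpace ℝ (Fin 3) → ℝ}

/-- Fubini: a jointly a.e.-strongly measurable `F` on `(0,T) × X` with `∫ |F(t,·)| ≤ K < ∞`
uniformly has `t ↦ ∫ F(t,x) dx` integrable on `(0, T)`. [folklore] -/
theorem integrableOn_integral_of_lintegral_le {X : Type*} [MeasurableSpace X] {μ : Measure X}
    [SFinite μ] {T : ℝ} {F : ℝ → X → ℝ}
    (hmeas : AEStronglyMeasurable (uncurry F) ((volume.restrict (Ioo 0 T)).prod μ))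
    {K : ℝ≥0∞} (hK : K ≠ ⊤) (hbound : ∀ t ∈ Ioo 0 T, ∫⁻ x, ‖F t x‖ₑ ∂μ ≤ K) :
    IntegrableOn (fun t => ∫ x, F t x ∂μ) (Ioo 0 T) := by
  have hI : Integrable (uncurry F) ((volume.restrict (Ioo 0 T)).prod μ) := by
    refine ⟨hmeas, ?_⟩
    have hle' := lintegral_prod_le (μ := volume.restrict (Ioo 0 T)) (ν := μ)
      (fun z : ℝ × X => ‖uncurry F z‖ₑ)
    refine lt_of_le_of_lt hle' ?_
    calc ∫⁻ t in Ioo 0 T, ∫⁻ x, ‖uncurry F (t, x)‖ₑ ∂μ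
        ≤ ∫⁻ _ in Ioo 0 T, K := setLIntegral_mono' measurableSet_Ioo fun t ht => hbound t ht
      _ < ⊤ := by
          rw [setLIntegral_const]
          exact ENNReal.mul_lt_top hK.lt_top (by simp)
  exact hI.integral_prod_left

/-- **Integrability in time of the weighted vorticity pairings** (hypotheses as in
`IsTaoSolutionOn.integral_sq_eq_of_repr`): `t ↦ ∫ g(t) g'(t)` is integrable on `(0, T)`.
[folklore] -/
theorem IsTaoSolutionOn.integrableOn_integral_mul_of_repr (h : IsTaoSolutionOn T ν u₀ v q) (hT : 0 < T)
    {g g' : ℝ → EuclideanSpace ℝ (Fin 3) → ℝ} {a : EuclideanSpace ℝ (Fin 3) → EuclideanSpace ℝ (Fin 3)}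
    (ha : Continuous a)
    (hg : ∀ t ∈ Icc 0 T, ∀ x, cylRadius x ≠ 0 →
      g t x = (cylRadius x ^ 2)⁻¹ * ⟪a x, vorticity v t x⟫)
    (hg' : ∀ t ∈ Icc 0 T, ∀ x, cylRadius x ≠ 0 →
      g' t x = (cylRadius x ^ 2)⁻¹ * ⟪a x, curl (timeDerivWithin (Icc 0 T) v t) x⟫)
    (hgc : ∀ t ∈ Icc 0 T, Continuous (g t))
    {C : ℝ≥0} (hgb : ∀ t ∈ Icc 0 T, ∫⁻ x, ‖g t x‖ₑ ^ 2 ≤ C) (hg'b : ∀ t ∈ Icc 0 T, ∫⁻ x, ‖g' t x‖ₑ ^ 2 ≤ C) :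
    IntegrableOn (fun t => ∫ x, g t x * g' t x) (Ioo 0 T) := by
  have hU : UniqueDiffOn ℝ (Icc 0 T) := uniqueDiffOn_Icc hT
  have hcl := Icc_subset_closure_interior_Icc' hT
  have hsm : IsSmoothSpaceTimeOn (Icc 0 T) v := h.classical.smooth_velocity
  have hω : IsSmoothSpaceTimeOn (Icc 0 T) (vorticity v) := hsm.isSmoothSpaceTimeOn_vorticity hU
  have hω' : IsSmoothSpaceTimeOn (Icc 0 T) (timeDerivWithin (Icc 0 T) (vorticity v)) := hω.timeDerivWithin hU
  have hcurl : ∀ t ∈ Icc 0 T, timeDerivWithin (Icc 0 T) (vorticity v) t = curl (timeDerivWithin (Icc 0 T) v t) :=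
    fun t ht => hsm.timeDerivWithin_vorticity_eq hU hcl ht
  refine integrableOn_integral_of_lintegral_le (F := fun t x => g t x * g' t x) ?_ (K := (C : ℝ≥0∞) + C)
    (by simp) ?_
  · refine aestronglyMeasurable_prod_of_continuousOn_off_axis (F := uncurry fun t x => g t x * g' t x) ?_
    have cω : ContinuousOn (uncurry (vorticity v)) (Icc 0 T ×ˢ univ) := hω.continuousOn
    have cω' : ContinuousOn (uncurry (timeDerivWithin (Icc 0 T) (vorticity v))) (Icc 0 T ×ˢ univ) :=
      hω'.continuousOn
    have hsub : Ioo 0 T ×ˢ {x : EuclideanSpace ℝ (Fin 3) | cylRadius x ≠ 0} ⊆ Icc 0 T ×ˢ univ :=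
      prod_mono Ioo_subset_Icc_self (subset_univ _)
    have cr : ContinuousOn (fun p : ℝ × EuclideanSpace ℝ (Fin 3) => (cylRadius p.2 ^ 2)⁻¹)
        (Ioo 0 T ×ˢ {x | cylRadius x ≠ 0}) := by
      refine ((continuous_cylRadius.comp continuous_snd).pow 2).continuousOn.inv₀ fun p hp => ?_
      exact pow_ne_zero 2 hp.2
    have ca : Continuous fun p : ℝ × EuclideanSpace ℝ (Fin 3) => a p.2 := ha.comp continuous_snd
    have cF : ContinuousOn (fun p : ℝ × EuclideanSpace ℝ (Fin 3) =>
        ((cylRadius p.2 ^ 2)⁻¹ * ⟪a p.2, uncurry (vorticity v) p⟫) *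
          ((cylRadius p.2 ^ 2)⁻¹ * ⟪a p.2, uncurry (timeDerivWithin (Icc 0 T) (vorticity v)) p⟫))
        (Ioo 0 T ×ˢ {x | cylRadius x ≠ 0}) :=
      (cr.mul (ca.continuousOn.inner (cω.mono hsub))).mul (cr.mul (ca.continuousOn.inner (cω'.mono hsub)))
    refine cF.congr fun p hp => ?_
    obtain ⟨t, x⟩ := p
    have ht : t ∈ Icc 0 T := Ioo_subset_Icc_self hp.1
    simp only [uncurry_apply_pair]
    rw [hg t ht x hp.2, hg' t ht x hp.2, hcurl t ht]
  · intro t ht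
    have htI : t ∈ Icc 0 T := Ioo_subset_Icc_self ht
    calc ∫⁻ x, ‖g t x * g' t x‖ₑ ≤ ∫⁻ x, (‖g t x‖ₑ ^ 2 + ‖g' t x‖ₑ ^ 2) :=
          lintegral_mono fun x => by rw [enorm_mul]; exact ennreal_mul_le_sq_add_sq _ _
      _ = (∫⁻ x, ‖g t x‖ₑ ^ 2) + ∫⁻ x, ‖g' t x‖ₑ ^ 2 :=
          lintegral_add_left ((hgc t htI).measurable.enorm.pow_const 2) _
      _ ≤ C + C := add_le_add (hgb t htI) (hg'b t htI)

/-- `t ↦ ∫ Ω(t) Ω'(t)` is integrable on `(0, T)` along a Tao-class solution with axisymmetric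
slices. [folklore] -/
theorem IsTaoSolutionOn.integrableOn_integral_angVortQuot_mul (h : IsTaoSolutionOn T ν u₀ v q) (hT : 0 < T)
    (hax : ∀ t ∈ Icc 0 T, IsAxisymmetric (v t)) :
    IntegrableOn (fun t => ∫ x, angVortQuot (v t) x * angVortQuot (timeDerivWithin (Icc 0 T) v t) x)
      (Ioo 0 T) := by
  have hU : UniqueDiffOn ℝ (Icc 0 T) := uniqueDiffOn_Icc hT
  have hsm : IsSmoothSpaceTimeOn (Icc 0 T) v := h.classical.smooth_velocity
  have hvs : ∀ t ∈ Icc 0 T, ContDiff ℝ ∞ (v t) := fun t ht => h.classical.contDiff_velocity ht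
  have hws : ∀ t ∈ Icc 0 T, ContDiff ℝ ∞ (timeDerivWithin (Icc 0 T) v t) := fun t ht =>
    hsm.contDiff_timeDerivWithin_slice hU ht
  have hwax : ∀ t ∈ Icc 0 T, IsAxisymmetric (timeDerivWithin (Icc 0 T) v t) := fun t ht =>
    hsm.isAxisymmetric_timeDerivWithin hax ht
  obtain ⟨C, hC⟩ := h.exists_lintegral_sq_quot_le hT hax
  refine h.integrableOn_integral_mul_of_repr hT (a := rotGen) (g := fun t x => angVortQuot (v t) x)
    (g' := fun t x => angVortQuot (timeDerivWithin (Icc 0 T) v t) x) ?_ ?_ ?_ ?_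
    (fun t ht => (hC t ht).1) (fun t ht => (hC t ht).2.1)
  · exact (rotGenL).continuous
  · intro t ht x hx
    have h3 : ContDiff ℝ 3 (v t) := (hvs t ht).of_le (by norm_cast)
    have e := (hax t ht).cylRadius_sq_mul_angVortQuot h3 x
    rw [swirl_eq_inner_rotGen] at e
    simp only at e
    show angVortQuot (v t) x = (cylRadius x ^ 2)⁻¹ * ⟪rotGen x, curl (v t) x⟫
    rw [← e, ← mul_assoc, inv_mul_cancel₀ (pow_ne_zero 2 hx), one_mul]
  · intro t ht x hx
    have h3 : ContDiff ℝ 3 (timeDerivWithin (Icc 0 T) v t) := (hws t ht).of_le (by norm_cast)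
    have e := (hwax t ht).cylRadius_sq_mul_angVortQuot h3 x
    rw [swirl_eq_inner_rotGen] at e
    simp only at e
    show angVortQuot (timeDerivWithin (Icc 0 T) v t) x =
      (cylRadius x ^ 2)⁻¹ * ⟪rotGen x, curl (timeDerivWithin (Icc 0 T) v t) x⟫
    rw [← e, ← mul_assoc, inv_mul_cancel₀ (pow_ne_zero 2 hx), one_mul]
  · intro t ht
    exact (contDiff_angVortQuot (n := 0) (by exact_mod_cast (hvs t ht).of_le (by norm_cast))).continuous

/-- `t ↦ ∫ J(t) J'(t)` is integrable on `(0, T)` along a Tao-class solution with axisymmetric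
slices. [folklore] -/
theorem IsTaoSolutionOn.integrableOn_integral_radVelQuot_curl_mul (h : IsTaoSolutionOn T ν u₀ v q)
    (hT : 0 < T) (hax : ∀ t ∈ Icc 0 T, IsAxisymmetric (v t)) :
    IntegrableOn (fun t => ∫ x, radVelQuot (curl (v t)) x *
      radVelQuot (curl (timeDerivWithin (Icc 0 T) v t)) x) (Ioo 0 T) := by
  have hU : UniqueDiffOn ℝ (Icc 0 T) := uniqueDiffOn_Icc hT
  have hsm : IsSmoothSpaceTimeOn (Icc 0 T) v := h.classical.smooth_velocity
  have hvs : ∀ t ∈ Icc 0 T, ContDiff ℝ ∞ (v t) := fun t ht => h.classical.contDiff_velocity ht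
  have hws : ∀ t ∈ Icc 0 T, ContDiff ℝ ∞ (timeDerivWithin (Icc 0 T) v t) := fun t ht =>
    hsm.contDiff_timeDerivWithin_slice hU ht
  have hwax : ∀ t ∈ Icc 0 T, IsAxisymmetric (timeDerivWithin (Icc 0 T) v t) := fun t ht =>
    hsm.isAxisymmetric_timeDerivWithin hax ht
  have hcs : ∀ {w : EuclideanSpace ℝ (Fin 3) → EuclideanSpace ℝ (Fin 3)}, ContDiff ℝ ∞ w →
      ContDiff ℝ 2 (curl w) := fun hw => by
    rw [curl_eq_curlCLM_comp]
    exact curlCLM.contDiff.comp ((hw.of_le (by norm_cast)).fderiv_right (m := 2) (by norm_cast))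
  obtain ⟨C, hC⟩ := h.exists_lintegral_sq_quot_le hT hax
  refine h.integrableOn_integral_mul_of_repr hT (a := fun x => toLp 2 ![x 0, x 1, 0])
    (g := fun t x => radVelQuot (curl (v t)) x)
    (g' := fun t x => radVelQuot (curl (timeDerivWithin (Icc 0 T) v t)) x) ?_ ?_ ?_ ?_
    (fun t ht => (hC t ht).2.2.1) (fun t ht => (hC t ht).2.2.2)
  · fun_prop
  · intro t ht x hx
    have hωax : IsAxisymmetric (curl (v t)) := (hax t ht).curl ((hvs t ht).differentiable (by simp))
    have e := hωax.cylRadius_sq_mul_radVelQuot (hcs (hvs t ht)) x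
    show radVelQuot (curl (v t)) x =
      (cylRadius x ^ 2)⁻¹ * ⟪(toLp 2 ![x 0, x 1, 0] : EuclideanSpace ℝ (Fin 3)), curl (v t) x⟫
    rw [inner_horizontal, ← e, ← mul_assoc, inv_mul_cancel₀ (pow_ne_zero 2 hx), one_mul]
  · intro t ht x hx
    have hωax : IsAxisymmetric (curl (timeDerivWithin (Icc 0 T) v t)) :=
      (hwax t ht).curl ((hws t ht).differentiable (by simp))
    have e := hωax.cylRadius_sq_mul_radVelQuot (hcs (hws t ht)) x
    show radVelQuot (curl (timeDerivWithin (Icc 0 T) v t)) x = (cylRadius x ^ 2)⁻¹ *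
      ⟪(toLp 2 ![x 0, x 1, 0] : EuclideanSpace ℝ (Fin 3)), curl (timeDerivWithin (Icc 0 T) v t) x⟫
    rw [inner_horizontal, ← e, ← mul_assoc, inv_mul_cancel₀ (pow_ne_zero 2 hx), one_mul]
  · intro t ht
    exact (contDiff_radVelQuot (n := 0) (by exact_mod_cast hcs (hvs t ht))).continuous

end IntegrableOn

end Literature.Analysis.FluidPDE
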